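import Mathlib

/-!
# Crux K2 `PoloidalWindowRigidity` (stmt-NavierStokesRegularity-19708), line `z_shock` — R3 inhabitant census: an EXPLICIT TWISTING,
# GENUINELY NONLINEAR, HYPERBOLIC simple wave of the autonomous height-evolution — the rational PENCIL pattern `w = (1 − x)/(y + z)`

`--supports stmt-NavierStokesRegularity-19708 --as helper` (leafhand-ns-poloidalwindowdoor-3 g24, cell decomp-ns, 2026-09-01).  Class-free,
def-free, Mathlib only; companion of `…ZShockSimpleWaves` (same hand: characteristic simple waves solve the height-evolution; entire ones
are planar).  **No stub and no summit is closed by this file; Navier–Stokes regularity is NOT proved here (rung 0).**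

WHAT IS RECORDED.  The standing inhabitant census of the class-free deciding statement `hGN` (`…ZShockAutOfSliceLiouville`) had, up to
hand 3-g23, NO explicit solution of the autonomous height-evolution `w_zz + Λ(w)Δₕw + Λ'(w)|∇ₕw|² = 0` exhibiting the three point-clauses
of `hGN` at once (hyperbolic `Λ(w)|∇ₕw|² < 0`, genuinely nonlinear `Λ'(w) ≠ 0`, TWISTING `∂₀w_z·∂₁w − ∂₁w_z·∂₀w ≠ 0`); every explicit
family was planar, linearly degenerate or dead (3-g19 … 3-g23), and 3-g23 (e) asked whether such a pattern exists even locally.  Here is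
the simplest one, a simple wave in the sense of `…ZShockSimpleWaves` with the normal curve `n(s) = (1, s, s)`, null for the structure
function `Λ(s) = −s²/(1 + s²)` (`n₂² + Λ(n₀² + n₁²) = s² − s² = 0`):

  `w(x, y, z) = (1 − x)/(y + z)` on the half-space `{y + z ≠ 0}`,  `Λ(s) = −s²/(1 + s²) ≤ 0`,  `Λ'(s) = −2s/(1 + s²)²`.

* `pencil_solves` — with the closed-form partials (certified by the `hasDerivAt_pencil_*` lemmas: `w_x = −1/(y+z)`, `w_y = w_z = −(1−x)/(y+z)²`,
  `w_xx = 0`, `w_yy = w_zz = 2(1−x)/(y+z)³`) the height-evolution holds IDENTICALLY on `{y + z ≠ 0}`;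
* `pencil_type`, `pencil_twist`, `hasDerivAt_pencilΛ` / `pencilΛ'_ne_zero` — at every point with `x ≠ 1` (i.e. `w ≠ 0`) the pattern is
  strictly hyperbolic (`Λ(w)|∇ₕw|² = −w²/(y+z)² < 0`), genuinely nonlinear (`Λ'(w) ≠ 0`) and twisting (minor `= w/(y+z)³ ≠ 0`); the type is
  `≤ 0` everywhere (no elliptic point), as `hGN` demands;
* `pencil_levelPlane`, `pencil_axis_mem_levelPlane` — its level sets lie on the planes `x + s(y + z) = 1`, which all contain the line
  `{x = 1, y + z = 0}`: a PENCIL of characteristic planes through one line.  The pattern is singular exactly on the plane `y + z = 0`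
  through that axis — the global obstruction `…ZShockSimpleWaves.gram_eq_zero_of_levelPlanes` (non-parallel level planes must meet) made
  visible: no member of this mechanism is entire, and boundedness plays no role in that.

So every POINT-clause of `hGN` is jointly inhabited by an elementary closed form; what `hGN` really asserts is the absence of ENTIRE bounded
patterns, and for one-family (simple-wave) patterns entireness alone already fails.  Honest scope: kinematic, local, toy; `hGN` / R3 (two-sided
rigidity of the genuinely nonlinear 2+1-D wave equation for bounded entire data) stay XL, not in print. [folklore]
-/

noncomputable section

namespace Summit.NavierStokesRegularity.NavierStokesRegularity.Theorems.PoloidalWindowDoorPoloidalWindowRigidityZShockSimpleWavesPencil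

-- the summit and its single sub-problem share the name (CONVENTIONS §1)
set_option linter.dupNamespace false

open Set

/-! ## The closed-form partial derivatives of `w = (1 − x)/(y + z)` -/

/-- `∂_z w = −(1−x)/(y+z)²` (and, by the symmetry `y ↔ z`, `∂_y w`). [folklore] -/
theorem hasDerivAt_pencil_z (x y z : ℝ) (h : y + z ≠ 0) :
    HasDerivAt (fun t : ℝ => (1 - x) / (y + t)) (-(1 - x) / (y + z) ^ 2) z := by
  have h1 : HasDerivAt (fun t : ℝ => y + t) 1 z := (hasDerivAt_id z).const_add y
  have h2 : HasDerivAt (fun t : ℝ => (1 - x) * (y + t)⁻¹) ((1 - x) * (-1 / (y + z) ^ 2)) z :=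
    (h1.inv h).const_mul (1 - x)
  have heq : (fun t : ℝ => (1 - x) / (y + t)) = fun t => (1 - x) * (y + t)⁻¹ := by
    funext t; rw [div_eq_mul_inv]
  rw [heq]
  exact h2.congr_deriv (by ring)

/-- `∂_y w = −(1−x)/(y+z)²`. [folklore] -/
theorem hasDerivAt_pencil_y (x y z : ℝ) (h : y + z ≠ 0) :
    HasDerivAt (fun t : ℝ => (1 - x) / (t + z)) (-(1 - x) / (y + z) ^ 2) y := by
  have h1 : HasDerivAt (fun t : ℝ => t + z) 1 y := (hasDerivAt_id y).add_const z
  have h2 : HasDerivAt (fun t : ℝ => (1 - x) * (t + z)⁻¹) ((1 - x) * (-1 / (y + z) ^ 2)) y :=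
    (h1.inv h).const_mul (1 - x)
  have heq : (fun t : ℝ => (1 - x) / (t + z)) = fun t => (1 - x) * (t + z)⁻¹ := by
    funext t; rw [div_eq_mul_inv]
  rw [heq]
  exact h2.congr_deriv (by ring)

/-- `∂_x w = −1/(y+z)`. [folklore] -/
theorem hasDerivAt_pencil_x (x y z : ℝ) :
    HasDerivAt (fun t : ℝ => (1 - t) / (y + z)) (-1 / (y + z)) x :=
  ((hasDerivAt_id x).const_sub 1).div_const (y + z)

/-- `∂_x∂_x w = 0`: the derivative of the constant `x`-slope `−1/(y+z)`. [folklore] -/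
theorem hasDerivAt_pencil_xx (x y z : ℝ) :
    HasDerivAt (fun _ : ℝ => -1 / (y + z)) 0 x :=
  hasDerivAt_const x _

/-- `∂_z∂_z w = 2(1−x)/(y+z)³`: the `z`-derivative of `∂_z w = −(1−x)/(y+z)²`. [folklore] -/
theorem hasDerivAt_pencil_zz (x y z : ℝ) (h : y + z ≠ 0) :
    HasDerivAt (fun t : ℝ => -(1 - x) / (y + t) ^ 2) (2 * (1 - x) / (y + z) ^ 3) z := by
  have h1 : HasDerivAt (fun t : ℝ => y + t) 1 z := (hasDerivAt_id z).const_add y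
  have h1' : HasDerivAt (fun t : ℝ => (y + t) ^ 2) (2 * (y + z)) z := by
    have hc := (hasDerivAt_pow 2 (y + z)).comp z h1
    have heq2 : (fun t : ℝ => (y + t) ^ 2) = (fun r : ℝ => r ^ 2) ∘ (fun t : ℝ => y + t) := rfl
    rw [heq2]
    exact hc.congr_deriv (by norm_num)
  have h2 : HasDerivAt (fun t : ℝ => -(1 - x) * ((y + t) ^ 2)⁻¹) (-(1 - x) * (-(2 * (y + z)) / ((y + z) ^ 2) ^ 2)) z :=
    (h1'.inv (pow_ne_zero 2 h)).const_mul (-(1 - x))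
  have heq : (fun t : ℝ => -(1 - x) / (y + t) ^ 2) = fun t => -(1 - x) * ((y + t) ^ 2)⁻¹ := by
    funext t; rw [div_eq_mul_inv]
  rw [heq]
  refine h2.congr_deriv ?_
  field_simp

/-- `∂_y∂_y w = 2(1−x)/(y+z)³`. [folklore] -/
theorem hasDerivAt_pencil_yy (x y z : ℝ) (h : y + z ≠ 0) :
    HasDerivAt (fun t : ℝ => -(1 - x) / (t + z) ^ 2) (2 * (1 - x) / (y + z) ^ 3) y := by
  have h1 : HasDerivAt (fun t : ℝ => t + z) 1 y := (hasDerivAt_id y).add_const z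
  have h1' : HasDerivAt (fun t : ℝ => (t + z) ^ 2) (2 * (y + z)) y := by
    have hc := (hasDerivAt_pow 2 (y + z)).comp y h1
    have heq2 : (fun t : ℝ => (t + z) ^ 2) = (fun r : ℝ => r ^ 2) ∘ (fun t : ℝ => t + z) := rfl
    rw [heq2]
    exact hc.congr_deriv (by norm_num)
  have h2 : HasDerivAt (fun t : ℝ => -(1 - x) * ((t + z) ^ 2)⁻¹) (-(1 - x) * (-(2 * (y + z)) / ((y + z) ^ 2) ^ 2)) y :=
    (h1'.inv (pow_ne_zero 2 h)).const_mul (-(1 - x))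
  have heq : (fun t : ℝ => -(1 - x) / (t + z) ^ 2) = fun t => -(1 - x) * ((t + z) ^ 2)⁻¹ := by
    funext t; rw [div_eq_mul_inv]
  rw [heq]
  refine h2.congr_deriv ?_
  field_simp

/-- `∂_x∂_z w = 1/(y+z)²`: the `x`-derivative of `∂_z w = −(1−x)/(y+z)²`. [folklore] -/
theorem hasDerivAt_pencil_xz (x y z : ℝ) :
    HasDerivAt (fun t : ℝ => -(1 - t) / (y + z) ^ 2) (1 / (y + z) ^ 2) x := by
  have heq : (fun t : ℝ => -(1 - t) / (y + z) ^ 2) = fun t => (t - 1) / (y + z) ^ 2 := by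
    funext t; ring
  rw [heq]
  exact ((hasDerivAt_id x).sub_const 1).div_const ((y + z) ^ 2)

/-- `∂_y∂_z w = 2(1−x)/(y+z)³`: the `y`-derivative of `∂_z w = −(1−x)/(y+z)²`. [folklore] -/
theorem hasDerivAt_pencil_yz (x y z : ℝ) (h : y + z ≠ 0) :
    HasDerivAt (fun t : ℝ => -(1 - x) / (t + z) ^ 2) (2 * (1 - x) / (y + z) ^ 3) y :=
  hasDerivAt_pencil_yy x y z h

/-! ## The structure function `Λ(s) = −s²/(1+s²)` -/

/-- `Λ(s) = −s²/(1+s²)` has derivative `Λ'(s) = −2s/(1+s²)²`. [folklore] -/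
theorem hasDerivAt_pencilΛ (s : ℝ) :
    HasDerivAt (fun r : ℝ => -r ^ 2 / (1 + r ^ 2)) (-2 * s / (1 + s ^ 2) ^ 2) s := by
  have hpos : (1 + s ^ 2) ≠ 0 := by positivity
  have hsq : HasDerivAt (fun r : ℝ => r ^ 2) (2 * s) s := (hasDerivAt_pow 2 s).congr_deriv (by norm_num)
  have h1 : HasDerivAt (fun r : ℝ => -r ^ 2) (-(2 * s)) s := hsq.neg
  have h2 : HasDerivAt (fun r : ℝ => 1 + r ^ 2) (2 * s) s := hsq.const_add 1
  refine (h1.div h2 hpos).congr_deriv ?_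
  field_simp
  ring

/-- `Λ ≤ 0` on `ℝ` (no elliptic value) and `Λ < 0` off `s = 0`. [folklore] -/
theorem pencilΛ_nonpos (s : ℝ) : -s ^ 2 / (1 + s ^ 2) ≤ 0 ∧ (s ≠ 0 → -s ^ 2 / (1 + s ^ 2) < 0) := by
  have hpos : 0 < 1 + s ^ 2 := by positivity
  refine ⟨div_nonpos_of_nonpos_of_nonneg (by nlinarith [sq_nonneg s]) hpos.le, fun hs => ?_⟩
  exact div_neg_of_neg_of_pos (by nlinarith [sq_pos_of_ne_zero hs]) hpos

/-- Genuine nonlinearity off `s = 0`: `Λ'(s) = −2s/(1+s²)² ≠ 0` for `s ≠ 0`. [folklore] -/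
theorem pencilΛ'_ne_zero {s : ℝ} (hs : s ≠ 0) : -2 * s / (1 + s ^ 2) ^ 2 ≠ 0 := by
  have hpos : (1 + s ^ 2) ^ 2 ≠ 0 := by positivity
  exact div_ne_zero (by simpa using hs) hpos

/-! ## The pattern solves the height-evolution, is hyperbolic, genuinely nonlinear and twisting -/

/-- ★ **`w = (1 − x)/(y + z)` solves `w_zz + Λ(w)(w_xx + w_yy) + Λ'(w)(w_x² + w_y²) = 0` on `{y + z ≠ 0}`** for
`Λ(s) = −s²/(1+s²)`, with the closed-form partials of the `hasDerivAt_pencil_*` lemmas. [folklore] -/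
theorem pencil_solves (x y z : ℝ) (h : y + z ≠ 0) :
    let w := (1 - x) / (y + z)
    2 * (1 - x) / (y + z) ^ 3 + (-w ^ 2 / (1 + w ^ 2)) * (0 + 2 * (1 - x) / (y + z) ^ 3) +
        (-2 * w / (1 + w ^ 2) ^ 2) * ((-1 / (y + z)) ^ 2 + (-(1 - x) / (y + z) ^ 2) ^ 2) = 0 := by
  intro w
  have hw : w = (1 - x) / (y + z) := rfl
  have h1 : (1 : ℝ) + w ^ 2 ≠ 0 := by positivity
  rw [hw] at h1 ⊢
  field_simp
  ring

/-- **Type.**  `Λ(w)|∇ₕw|² = −w²/(y+z)²`: non-positive everywhere, strictly negative (hyperbolic) wherever `x ≠ 1`. [folklore] -/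
theorem pencil_type (x y z : ℝ) (h : y + z ≠ 0) :
    let w := (1 - x) / (y + z)
    (-w ^ 2 / (1 + w ^ 2)) * ((-1 / (y + z)) ^ 2 + (-(1 - x) / (y + z) ^ 2) ^ 2) = -(w ^ 2 / (y + z) ^ 2) ∧
      -(w ^ 2 / (y + z) ^ 2) ≤ 0 ∧ (x ≠ 1 → -(w ^ 2 / (y + z) ^ 2) < 0) := by
  intro w
  have hw : w = (1 - x) / (y + z) := rfl
  have h1 : (1 : ℝ) + w ^ 2 ≠ 0 := by positivity
  refine ⟨?_, ?_, fun hx => ?_⟩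
  · rw [hw] at h1 ⊢
    field_simp
  · have : 0 ≤ w ^ 2 / (y + z) ^ 2 := by positivity
    linarith
  · have hwne : w ≠ 0 := by
      rw [hw]; exact div_ne_zero (sub_ne_zero.mpr (Ne.symm hx)) h
    have : 0 < w ^ 2 / (y + z) ^ 2 := by positivity
    linarith

/-- **Twist.**  The twisting minor `∂ₓw_z·∂_yw − ∂_yw_z·∂ₓw` equals `w/(y+z)³`, non-zero wherever `x ≠ 1`: the horizontal normal
`(1, w)` of the level plane TURNS with the value. [folklore] -/
theorem pencil_twist (x y z : ℝ) (h : y + z ≠ 0) :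
    let w := (1 - x) / (y + z)
    (1 / (y + z) ^ 2) * (-(1 - x) / (y + z) ^ 2) - (2 * (1 - x) / (y + z) ^ 3) * (-1 / (y + z)) = w / (y + z) ^ 3 ∧
      (x ≠ 1 → w / (y + z) ^ 3 ≠ 0) := by
  intro w
  have hw : w = (1 - x) / (y + z) := rfl
  refine ⟨?_, fun hx => ?_⟩
  · rw [hw]
    field_simp
    ring
  · have hwne : w ≠ 0 := by
      rw [hw]; exact div_ne_zero (sub_ne_zero.mpr (Ne.symm hx)) h
    exact div_ne_zero hwne (pow_ne_zero 3 h)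

/-! ## The pencil of characteristic level planes -/

/-- **Level sets are planes of the null family `n(s) = (1, s, s)`.**  On `{y + z ≠ 0}`, `w(x,y,z) = s ↔ x + s·y + s·z = 1`; and the normal
`(1, s, s)` is null for `Λ`: `s·s + Λ(s)(1 + s·s) = 0`. [folklore] -/
theorem pencil_levelPlane (x y z s : ℝ) (h : y + z ≠ 0) :
    ((1 - x) / (y + z) = s ↔ 1 * x + s * y + s * z = 1) ∧ s * s + (-s ^ 2 / (1 + s ^ 2)) * (1 * 1 + s * s) = 0 := by
  have h1 : (1 : ℝ) + s ^ 2 ≠ 0 := by positivity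
  refine ⟨?_, ?_⟩
  · rw [div_eq_iff h]
    constructor <;> intro hh <;> linarith
  · field_simp
    ring

/-- **All level planes pass through the axis `{x = 1, y + z = 0}`** — a pencil: the point `(1, t, −t)` lies on `x + s·y + s·z = 1` for
every value `s`.  Non-parallel level planes meet (here: along a whole common line), so the pattern cannot extend across `y + z = 0`:
the global obstruction of `…ZShockSimpleWaves` in closed form. [folklore] -/
theorem pencil_axis_mem_levelPlane (s t : ℝ) : 1 * (1 : ℝ) + s * t + s * (-t) = 1 := by
  ring

/-! ## Appended (same hand): the OBLIQUE PENCIL `w = (1 − x − z)/y` — strictly hyperbolic and twisting at EVERY point, height-affine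

Second explicit simple wave, normal curve `n(s) = (1, s, 1)` (planes `x + s·y + z = 1`, a pencil through the line `{y = 0, x + z = 1}`),
null for `Λ(s) = −1/(1 + s²)`: `n₂² + Λ(n₀² + n₁²) = 1 − (1 + s²)/(1 + s²) = 0`.  Here `Λ < 0` at EVERY value (no degenerate value, unlike the
first pencil), `Λ'(s) = 2s/(1+s²)² ≠ 0` off `s = 0`, the type is `Λ(w)|∇ₕw|² = −1/y² < 0` EVERYWHERE and the twisting minor is `1/y³ ≠ 0`
EVERYWHERE on `{y ≠ 0}`.  Moreover `w_zz ≡ 0`: the pattern is HEIGHT-AFFINE (`w = A + zB`, `A = (1−x)/y`, `B = −1/y`; `𝒢(w)` slice-harmonic),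
so the census entry «height-affine patterns are dead» (3-g19 A3) is — like the simple-wave sector — a statement about ENTIRE patterns only
(there `B⁻¹ = −y` would have to be an entire one-signed harmonic function). -/

section ObliquePencil

/-- `Λ(s) = −1/(1+s²)` has derivative `2s/(1+s²)²`. [folklore] -/
theorem hasDerivAt_obliqueΛ (s : ℝ) :
    HasDerivAt (fun r : ℝ => -1 / (1 + r ^ 2)) (2 * s / (1 + s ^ 2) ^ 2) s := by
  have hpos : (1 + s ^ 2) ≠ 0 := by positivity
  have hsq : HasDerivAt (fun r : ℝ => r ^ 2) (2 * s) s := (hasDerivAt_pow 2 s).congr_deriv (by norm_num)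
  have h2 : HasDerivAt (fun r : ℝ => 1 + r ^ 2) (2 * s) s := hsq.const_add 1
  have h3 := (h2.inv hpos).const_mul (-1 : ℝ)
  have heq : (fun r : ℝ => -1 / (1 + r ^ 2)) = fun r => (-1 : ℝ) * (1 + r ^ 2)⁻¹ := by
    funext r; rw [div_eq_mul_inv]
  rw [heq]
  refine h3.congr_deriv ?_
  field_simp

/-- `Λ(s) = −1/(1+s²) < 0` at EVERY value (strict hyperbolicity everywhere), and `Λ'(s) ≠ 0` off `s = 0`. [folklore] -/
theorem obliqueΛ_neg (s : ℝ) : -1 / (1 + s ^ 2) < 0 ∧ (s ≠ 0 → 2 * s / (1 + s ^ 2) ^ 2 ≠ 0) := by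
  have hpos : 0 < 1 + s ^ 2 := by positivity
  refine ⟨div_neg_of_neg_of_pos (by norm_num) hpos, fun hs => ?_⟩
  exact div_ne_zero (by simpa using hs) (by positivity)

/-- `∂ₓw = ∂_zw = −1/y` for `w = (1 − x − z)/y`: in `x`. [folklore] -/
theorem hasDerivAt_oblique_x (x y z : ℝ) :
    HasDerivAt (fun t : ℝ => (1 - t - z) / y) (-1 / y) x := by
  have h1 : HasDerivAt (fun t : ℝ => 1 - t - z) (-1) x := by
    simpa using ((hasDerivAt_id x).const_sub 1).sub_const z
  exact h1.div_const y

/-- `∂_zw = −1/y`. [folklore] -/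
theorem hasDerivAt_oblique_z (x y z : ℝ) :
    HasDerivAt (fun t : ℝ => (1 - x - t) / y) (-1 / y) z := by
  have h1 : HasDerivAt (fun t : ℝ => 1 - x - t) (-1) z := by
    simpa using (hasDerivAt_id z).const_sub (1 - x)
  exact h1.div_const y

/-- `∂_yw = −(1 − x − z)/y²`. [folklore] -/
theorem hasDerivAt_oblique_y (x y z : ℝ) (h : y ≠ 0) :
    HasDerivAt (fun t : ℝ => (1 - x - z) / t) (-(1 - x - z) / y ^ 2) y := by
  have h2 := ((hasDerivAt_id y).inv h).const_mul (1 - x - z)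
  have heq : (fun t : ℝ => (1 - x - z) / t) = fun t => (1 - x - z) * (id t)⁻¹ := by
    funext t; rw [div_eq_mul_inv]; rfl
  rw [heq]
  exact h2.congr_deriv (by simp; ring)

/-- `∂_y∂_yw = 2(1 − x − z)/y³`: the `y`-derivative of `∂_yw`. [folklore] -/
theorem hasDerivAt_oblique_yy (x y z : ℝ) (h : y ≠ 0) :
    HasDerivAt (fun t : ℝ => -(1 - x - z) / t ^ 2) (2 * (1 - x - z) / y ^ 3) y := by
  have h1 : HasDerivAt (fun t : ℝ => t ^ 2) (2 * y) y := (hasDerivAt_pow 2 y).congr_deriv (by norm_num)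
  have h2 := (h1.inv (pow_ne_zero 2 h)).const_mul (-(1 - x - z))
  have heq : (fun t : ℝ => -(1 - x - z) / t ^ 2) = fun t => -(1 - x - z) * (t ^ 2)⁻¹ := by
    funext t; rw [div_eq_mul_inv]
  rw [heq]
  refine h2.congr_deriv ?_
  field_simp

/-- `∂_y∂_zw = 1/y²`: the `y`-derivative of `∂_zw = −1/y`. [folklore] -/
theorem hasDerivAt_oblique_yz (y : ℝ) (h : y ≠ 0) :
    HasDerivAt (fun t : ℝ => -1 / t) (1 / y ^ 2) y := by
  have h2 := ((hasDerivAt_id y).inv h).const_mul (-1 : ℝ)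
  have heq : (fun t : ℝ => -1 / t) = fun t => (-1 : ℝ) * (id t)⁻¹ := by
    funext t; rw [div_eq_mul_inv]; rfl
  rw [heq]
  refine h2.congr_deriv ?_
  simp only [id]
  field_simp

/-- The remaining second partials are derivatives of constants: `∂ₓ∂ₓw = ∂_z∂_zw = ∂ₓ∂_zw = 0` (`∂ₓw = ∂_zw = −1/y` do not depend on `x`, `z`). [folklore] -/
theorem hasDerivAt_oblique_const (y t : ℝ) : HasDerivAt (fun _ : ℝ => -1 / y) 0 t :=
  hasDerivAt_const t _

/-- ★ **`w = (1 − x − z)/y` solves `w_zz + Λ(w)(w_xx + w_yy) + Λ'(w)(w_x² + w_y²) = 0` on `{y ≠ 0}`** for `Λ(s) = −1/(1+s²)`, with the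
closed-form partials above (`w_zz = w_xx = 0`, `w_yy = 2(1−x−z)/y³`, `w_x = −1/y`, `w_y = −(1−x−z)/y²`). [folklore] -/
theorem oblique_solves (x y z : ℝ) (h : y ≠ 0) :
    let w := (1 - x - z) / y
    0 + (-1 / (1 + w ^ 2)) * (0 + 2 * (1 - x - z) / y ^ 3) +
        (2 * w / (1 + w ^ 2) ^ 2) * ((-1 / y) ^ 2 + (-(1 - x - z) / y ^ 2) ^ 2) = 0 := by
  intro w
  have hw : w = (1 - x - z) / y := rfl
  have h1 : (1 : ℝ) + w ^ 2 ≠ 0 := by positivity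
  rw [hw] at h1 ⊢
  field_simp
  ring

/-- **Type: strictly hyperbolic EVERYWHERE.**  `Λ(w)|∇ₕw|² = −1/y² < 0` at every point of `{y ≠ 0}`. [folklore] -/
theorem oblique_type (x y z : ℝ) (h : y ≠ 0) :
    let w := (1 - x - z) / y
    (-1 / (1 + w ^ 2)) * ((-1 / y) ^ 2 + (-(1 - x - z) / y ^ 2) ^ 2) = -1 / y ^ 2 ∧ -1 / y ^ 2 < 0 := by
  intro w
  have hw : w = (1 - x - z) / y := rfl
  have h1 : (1 : ℝ) + w ^ 2 ≠ 0 := by positivity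
  refine ⟨?_, div_neg_of_neg_of_pos (by norm_num) (by positivity)⟩
  rw [hw] at h1 ⊢
  field_simp

/-- **Twist: EVERYWHERE.**  The twisting minor `∂ₓw_z·∂_yw − ∂_yw_z·∂ₓw = 0·∂_yw − (1/y²)·(−1/y) = 1/y³ ≠ 0` on `{y ≠ 0}`. [folklore] -/
theorem oblique_twist (x y z : ℝ) (h : y ≠ 0) :
    (0 : ℝ) * (-(1 - x - z) / y ^ 2) - (1 / y ^ 2) * (-1 / y) = 1 / y ^ 3 ∧ 1 / y ^ 3 ≠ 0 := by
  refine ⟨?_, div_ne_zero one_ne_zero (pow_ne_zero 3 h)⟩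
  field_simp
  ring

/-- **Level planes and their pencil.**  On `{y ≠ 0}`: `w = s ↔ x + s·y + z = 1`; the normal `(1, s, 1)` is null for `Λ`
(`1·1 + Λ(s)(1 + s·s) = 0`); and every plane of the family contains the line `{(t, 0, 1 − t)}`. [folklore] -/
theorem oblique_levelPlane (x y z s t : ℝ) (h : y ≠ 0) :
    ((1 - x - z) / y = s ↔ 1 * x + s * y + 1 * z = 1) ∧ (1 : ℝ) * 1 + (-1 / (1 + s ^ 2)) * (1 * 1 + s * s) = 0 ∧
      1 * t + s * 0 + 1 * (1 - t) = 1 := by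
  have h1 : (1 : ℝ) + s ^ 2 ≠ 0 := by positivity
  refine ⟨?_, ?_, by ring⟩
  · rw [div_eq_iff h]
    constructor <;> intro hh <;> linarith
  · field_simp
    ring

end ObliquePencil


end Summit.NavierStokesRegularity.NavierStokesRegularity.Theorems.PoloidalWindowDoorPoloidalWindowRigidityZShockSimpleWavesPencil
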